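import Summits.HodgeConjecture.HodgeConjecture.Theorems.SignSymmetricPowersPencilTransvections
import Literature.AlgebraicGeometry.HodgeTheory.MonomialSupportedHypersurfaceFamilyPoints
import Literature.AlgebraicGeometry.HodgeTheory.BettiUniverseOddCupAlternating
import Literature.AlgebraicGeometry.HodgeTheory.NodalPencilPicardLefschetz
import Summits.HodgeConjecture.HodgeConjecture.Theorems.SignSymmetricPowersPencilTransvectionsKeyed
import HarnessLib

/-!
# K1-B piece PEN of crux `VeryGeneralSignCommutatorsInHg` from hPL₂exch ALONE — the fixed-node transvections are now UNCONDITIONAL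
# (prover-Bx's `NodalPencil.picardLefschetz_oneNode_monomial`, p680592; P3 DECISION (2) 2026-08-29T00:07:12Z)

Prover seat `hodge-nonav-19716-p2` (g10), cell `hodge-nonav`; helper `--supports stmt-HodgeConjecture-19716`; sorry-free, no definition, no
new named fact.  Twin of `SignSymmetricPowersPencilTransvectionsKeyed` in which the one-node binder is REPLACED BY THE THEOREM
`NodalPencil.picardLefschetz_oneNode_monomial` (prover-Bx, p680592): the Π- and L-node clauses gain the hypothesis `∃ i a, g = a • X i ^ d` on their
co-pencil form (the telescope instantiates `g := x₄^d, x₀^d`) and need NO Picard–Lefschetz binder; the exchanged-pair clause is from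
`picardLefschetz_exchangedPair` as in the keyed file.  For every even `d ≥ 4`, every admissible ι-even `f` and each node type,
every small pencil circle around an ι-even nodal member, moved to `t` along any path, transports `H³(𝒴_t; ℚ)` by `U_r(c)`, `c ≠ 0`,
`B(r,r) = 0` (Π, L; no parity) resp. by `U_δ(c) U_{τδ}(c)` with `B(δ, τδ) = 0` (pair).  All the work is the transport kit
`SignSymmetricPowersPencilTransport` (`exists_transport_picardLefschetz`).

* `transvection_of_fixed_node_monomial` (UNCONDITIONAL), `signPencilTransvections_pair : picardLefschetz_exchangedPair → …` (the pair clause reuses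
  `SignSymmetricPowersPencilTransvectionsKeyed.transvections_of_exchanged_pair_keyed`).

Sorry-free; axioms standard.  CONDITIONAL; nothing here says HC is proved; rung F-H1 not moved.

## References

* [VoisinHodgeII2003] C. Voisin, Hodge Theory and Complex Algebraic Geometry II (CUP 2003), §3.2.1 Thm. 3.16, Cor. 3.17,
  §3.2.2, §2.2.1 Def. 2.12.
* [ArnoldGuseinzadeVarchenko2012] Arnold, Gusein-Zade, Varchenko, Singularities of Differentiable Maps II, Part I §1.3,
  p. 67 Corollary.
* [Deligne1980] P. Deligne, La conjecture de Weil II, §4.4.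
-/

noncomputable section

set_option linter.dupNamespace false

open CategoryTheory AlgebraicGeometry
open scoped LinearAlgebra.Projectivization
open Literature.AlgebraicTopology.SingularHomology
open Literature.AlgebraicGeometry.Motives Literature.AlgebraicGeometry.Motives.UniversalHypersurface
open Literature.AlgebraicGeometry.HodgeTheory Literature.AlgebraicGeometry.HodgeTheory.UniversalHypersurface
open Literature.AlgebraicGeometry.HodgeTheory.BettiUniverse
open Summit.HodgeConjecture.HodgeConjecture.Theorems.SignSymmetricPowersPencilTransport
open Summit.HodgeConjecture.HodgeConjecture.Theorems.SignSymmetricPowersPencilTransvections (oneParamTransvectionEquiv_congr)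

namespace Summit.HodgeConjecture.HodgeConjecture.Theorems.SignSymmetricPowersPencilTransvectionsPair

/-! ### §1 One fixed node: the moved pencil circle transports by a transvection (no parity recorded) -/

/-- **A pencil circle around an ι-even member with ONE node, moved to any base point, transports `H³` by a transvection
`U_r(c)`, `c ≠ 0`, `B(r, r) = 0`** — UNCONDITIONAL for a monomial co-pencil direction `g = a·xᵢ^d`: the Picard–Lefschetz datum of the universal
family at `[f₁ + ε g]` is prover-Bx's THEOREM `NodalPencil.picardLefschetz_oneNode_monomial` (p680592; the even-dimensional rider is void for
threefolds), moved by `exists_transport_picardLefschetz`.  (Parents: `transvection_of_fixed_node{,_flat,_keyed}`.)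
[cite: VoisinHodgeII2003, §3.2.1 Thm. 3.16 and §3.2.2] [cite: ArnoldGuseinzadeVarchenko2012, Part I §1.3] -/
theorem transvection_of_fixed_node_monomial {d : ℕ} (hd : 1 ≤ d)
    (M : Set (DegIndex 3 d)) (γ : Fin 5 → ℂˣ) (hγ : FixesMonomials ℂ 3 d M γ)
    (hU : IsCohomologicallyLocallyTrivialOn (familyM ℂ 3 d M) Set.univ)
    (p : Fin 5 → ℂ) (f₁ g : MvPolynomial (Fin 5) ℂ) (hf₁ : f₁.IsHomogeneous d) (hg : g.IsHomogeneous d)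
    (hgX : ∃ (i : Fin 5) (a : ℂ), g = a • MvPolynomial.X i ^ d)
    (hnod : IsNodalFormWithNodes f₁ ![p]) (hgp : ∀ i : Fin 1, MvPolynomial.eval (![p] i) g ≠ 0) :
    ∃ ε₀ : ℝ, 0 < ε₀ ∧ ∀ ε : ℝ, 0 < ε → ε < ε₀ → ∀ (t s : ComplexPoints (baseM ℂ 3 d M)) (β : Path t s)
      (ω : Path s s), pointFormM ℂ 3 d M s = f₁ + ((ε : ℝ) : ℂ) • g →
      IsPencilCircle 3 d f₁ g ε (ω.map (AlgPoints.mapContinuous (toBase ℂ 3 d M)).continuous) →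
      ∀ T : bettiCohomology (fiberOver (familyM ℂ 3 d M) t) 3 ≃ₗ[ℚ] bettiCohomology (fiberOver (familyM ℂ 3 d M) t) 3,
        IsRatTransport (familyM ℂ 3 d M) 3 hU ⟦((β.trans ω).trans β.symm).map
          (⟨fun s => ⟨s, Set.mem_univ s⟩, continuous_id.subtype_mk _⟩ : C(ComplexPoints (baseM ℂ 3 d M), (Set.univ : Set (ComplexPoints (baseM ℂ 3 d M))))).continuous⟧ T →
        ∃ (r : bettiCohomology (fiberOver (familyM ℂ 3 d M) t) 3) (c : ℚ)
          (hr : ((cup (fiberOver (familyM ℂ 3 d M) t) 3 3).compr₂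
            (tr (isSmoothProjective_fiberOver_familyM ℂ 3 d M (by decide) hd t) (3 + 3))) r r = 0),
          c ≠ 0 ∧ T = oneParamTransvectionEquiv _ hr c := by
  have hgp' : MvPolynomial.eval p g ≠ 0 := by have := hgp 0; rwa [Matrix.cons_val_fin_one] at this
  obtain ⟨i, a, rfl⟩ := hgX
  obtain ⟨ε₀, hε₀, -, hcirc⟩ := NodalPencil.picardLefschetz_oneNode_monomial 3 d (by decide) hd f₁ hf₁ p hnod i a hgp'
  refine ⟨ε₀, hε₀, fun ε hε hεε t s β ω hs hω T hT => ?_⟩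
  obtain ⟨δ₀, c₀, hPL⟩ := hcirc (UniversalHypersurface.isCohomologicallyLocallyTrivialOn_family 3 d hd) ε hε hεε
    (AlgPoints.map (toBase ℂ 3 d M) s) hs (ω.map (AlgPoints.mapContinuous (toBase ℂ 3 d M)).continuous) hω
    (fun he => absurd he (by decide))
  set δ : Fin 1 → bettiCohomology (fiberOver (family ℂ 3 d) (AlgPoints.map (toBase ℂ 3 d M) s)) 3 := ![δ₀] with hδ
  obtain ⟨c', Φ, hc', hform, ⟨ν, -, hsim⟩, -⟩ :=
    exists_transport_picardLefschetz 3 d M γ (by decide) hd hγ _ hU β ω hPL hT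
  have hr : ((cup (fiberOver (familyM ℂ 3 d M) t) 3 3).compr₂
      (tr (isSmoothProjective_fiberOver_familyM ℂ 3 d M (by decide) hd t) (3 + 3))) (Φ (δ 0)) (Φ (δ 0)) = 0 := by
    rw [LinearMap.compr₂_apply, hsim, hPL.odd (by decide) 0, mul_zero]
  refine ⟨Φ (δ 0), c', hr, hc', LinearEquiv.ext fun x => ?_⟩
  rw [hform x, oneParamTransvectionEquiv_apply, Fin.sum_univ_one, smul_smul, LinearMap.compr₂_apply]


/-! ### §2 An exchanged pair of nodes: see `SignSymmetricPowersPencilTransvectionsKeyed.transvections_of_exchanged_pair_keyed` (reused) -/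

/-! ### §3 The PEN statement with unsigned fixed centres, from the keyed binders -/

/-- **PEN with unsigned fixed centres, from hPL₂exch alone** (the registered stub `stub_signPencilTransvections` of skeleton v12d with its
antecedent replaced by `picardLefschetz_exchangedPair →`, the Π∕L clauses restricted to monomial directions and served by
`NodalPencil.picardLefschetz_oneNode_monomial`, and the two parity clauses dropped): for every
even `d ≥ 4`, every admissible ι-even `f` and each node type — Π-node `e₄`, L-node `e₀`, the exchanged pair `(±1:0:1:0:0)` — every
small pencil circle around an ι-even nodal member of that type, moved to `t` along any path, transports `H³(𝒴_t; ℚ)` by `U_r(c)`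
with `c ≠ 0`, `B(r,r) = 0` (Π, L), resp. by `U_δ(c) U_{τδ}(c)` with `B(δ, τδ) = 0` (pair; `γ • (−1:0:1:0:0) = (1:0:1:0:0)`).
[cite: VoisinHodgeII2003, §3.2.1 Thm. 3.16 and §3.2.2] [cite: ArnoldGuseinzadeVarchenko2012, Part I §1.3 and p. 67 Corollary] -/
theorem signPencilTransvections_pair :
    open Literature.AlgebraicGeometry.Motives Literature.AlgebraicGeometry.Motives.UniversalHypersurface Literature.AlgebraicGeometry.HodgeTheory Literature.AlgebraicGeometry.HodgeTheory.UniversalHypersurface Literature.AlgebraicGeometry.HodgeTheory.BettiUniverse CategoryTheory.Limits in picardLefschetz_exchangedPair → ∀ ⦃d : ℕ⦄, Even d → ∀ (h4 : 4 ≤ d), (let M : Set (DegIndex 3 d) := {m | Even (m.1 0 + m.1 1)}; let γ : Fin 5 → ℂˣ := fun i => if (i : ℕ) < 2 then -1 else 1; let u := familyM ℂ 3 d M; let hu : IsSmoothProjectiveFamily u 3 := isSmoothProjectiveFamily_familyM ℂ 3 d M (by decide) (le_trans (by decide) h4); let hU : IsCohomologicallyLocallyTrivialOn u (Set.univ : Set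 (ComplexPoints (baseM ℂ 3 d M))) := isCohomologicallyLocallyTrivialOn_familyM 3 d M (by decide) (le_trans (by decide) h4); let toU : C(ComplexPoints (baseM ℂ 3 d M), (Set.univ : Set (ComplexPoints (baseM ℂ 3 d M)))) := ⟨fun s => ⟨s, Set.mem_univ s⟩, continuous_id.subtype_mk _⟩; ∀ (hγ : FixesMonomials ℂ 3 d M γ) (t₀ : ComplexPoints (baseM ℂ 3 d M)) (f : MvPolynomial (Fin 5) ℂ) (hf : f.IsHomogeneous d) (hM : IsSupportedOn 3 d M f) (hJ : SmoothHypersurface.IsNonsingularForm ℂ f), let t := classifyingPoint ℂ 3 d M t₀ f; let Y := fiberOver u t; let hY : IsSmoothProjective 3 Y := hu.isSmoothProjective t; let B : LinearMap.BilinForm ℚ (bettiCohomology Y 3) := (cup Y 3 3).compr₂ (tr hY (3 + 3)); let τ : bettiCohomology Y 3 →ₗ[ℚ] bettiCohomology Y 3 := pull (sigmaMFiber ℂ 3 d M γ hγ t) 3; (∀ (f₁ g : MvPolynomial (Fin 5) ℂ), f₁.IsHomogeneous d → g.IsHomogeneous d → (∃ (i : Fin 5) (a : ℂ), g = a • MvPolynomial.X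 i ^ d) → IsSupportedOn 3 d M f₁ → IsSupportedOn 3 d M g → IsNodalFormWithNodes f₁ ![![0, 0, 0, 0, 1]] → (∀ i : Fin 1, MvPolynomial.eval (![![0, 0, 0, 0, 1]] i) g ≠ 0) → ∃ ε₀ : ℝ, 0 < ε₀ ∧ ∀ ε : ℝ, 0 < ε → ε < ε₀ → ∀ (s : ComplexPoints (baseM ℂ 3 d M)) (β : Path t s) (ω : Path s s), pointFormM ℂ 3 d M s = f₁ + ((ε : ℝ) : ℂ) • g → IsPencilCircle 3 d f₁ g ε (ω.map (AlgPoints.mapContinuous (toBase ℂ 3 d M)).continuous) → ∀ T : bettiCohomology Y 3 ≃ₗ[ℚ] bettiCohomology Y 3, IsRatTransport u 3 hU ⟦((β.trans ω).trans β.symm).map toU.continuous⟧ T → ∃ (r : bettiCohomology Y 3) (c : ℚ) (hr : B r r = 0), c ≠ 0 ∧ T = oneParamTransvectionEquiv B hr c) ∧ (∀ (f₁ g : MvPolynomial (Fin 5) ℂ), f₁.IsHomogeneous d → g.IsHomogeneous d → (∃ (i : Fin 5) (a : ℂ), g = a • MvPolynomial.X i ^ d) → IsSupportedOn 3 d M f₁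 → IsSupportedOn 3 d M g → IsNodalFormWithNodes f₁ ![![1, 0, 0, 0, 0]] → (∀ i : Fin 1, MvPolynomial.eval (![![1, 0, 0, 0, 0]] i) g ≠ 0) → ∃ ε₀ : ℝ, 0 < ε₀ ∧ ∀ ε : ℝ, 0 < ε → ε < ε₀ → ∀ (s : ComplexPoints (baseM ℂ 3 d M)) (β : Path t s) (ω : Path s s), pointFormM ℂ 3 d M s = f₁ + ((ε : ℝ) : ℂ) • g → IsPencilCircle 3 d f₁ g ε (ω.map (AlgPoints.mapContinuous (toBase ℂ 3 d M)).continuous) → ∀ T : bettiCohomology Y 3 ≃ₗ[ℚ] bettiCohomology Y 3, IsRatTransport u 3 hU ⟦((β.trans ω).trans β.symm).map toU.continuous⟧ T → ∃ (r : bettiCohomology Y 3) (c : ℚ) (hr : B r r = 0), c ≠ 0 ∧ T = oneParamTransvectionEquiv B hr c) ∧ (∀ (f₁ g : MvPolynomial (Fin 5) ℂ), f₁.IsHomogeneous d → g.IsHomogeneous d → IsSupportedOn 3 d M f₁ → IsSupportedOn 3 d M g → IsNodalFormWithNodes f₁ ![![1, 0, 1, 0, 0], ![-1, 0, 1, 0,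 0]] → (∀ i : Fin 2, MvPolynomial.eval (![![1, 0, 1, 0, 0], ![-1, 0, 1, 0, 0]] i) g ≠ 0) → ∃ ε₀ : ℝ, 0 < ε₀ ∧ ∀ ε : ℝ, 0 < ε → ε < ε₀ → ∀ (s : ComplexPoints (baseM ℂ 3 d M)) (β : Path t s) (ω : Path s s), pointFormM ℂ 3 d M s = f₁ + ((ε : ℝ) : ℂ) • g → IsPencilCircle 3 d f₁ g ε (ω.map (AlgPoints.mapContinuous (toBase ℂ 3 d M)).continuous) → ∀ T : bettiCohomology Y 3 ≃ₗ[ℚ] bettiCohomology Y 3, IsRatTransport u 3 hU ⟦((β.trans ω).trans β.symm).map toU.continuous⟧ T → ∃ (δ : bettiCohomology Y 3) (c : ℚ) (hδ : B δ δ = 0) (hδ' : B (τ δ) (τ δ) = 0), c ≠ 0 ∧ B δ (τ δ) = 0 ∧ T = oneParamTransvectionEquiv B hδ c * oneParamTransvectionEquiv B hδ' c)) := by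
  intro H d hd h4 M γ u hu hU toU hγ t₀ f hf hM hJ t Y hY B τ
  have hd1 : 1 ≤ d := le_trans (by decide) h4
  have hγ2 : γ * γ = 1 := by
    funext i
    simp only [γ, Pi.mul_apply, Pi.one_apply]
    split_ifs <;> simp
  have hγfin : IsOfFinOrder γ := isOfFinOrder_iff_pow_eq_one.2 ⟨2, two_pos, by rw [pow_two, hγ2]⟩
  refine ⟨?_, ?_, ?_⟩
  · -- Π-node `e₄` (no parity recorded)
    intro f₁ g hf₁ hg hgX hM₁ hMg hnod hgp
    obtain ⟨ε₀, hε₀, hh⟩ := transvection_of_fixed_node_monomial hd1 M γ hγ hU _ f₁ g hf₁ hg hgX hnod hgp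
    refine ⟨ε₀, hε₀, fun ε hε hεε s β ω hs hω T hT => ?_⟩
    obtain ⟨r, c, hr, hc, hT'⟩ := hh ε hε hεε t s β ω hs hω T hT
    exact ⟨r, c, hr, hc, hT'⟩
  · -- L-node `e₀` (no parity recorded)
    intro f₁ g hf₁ hg hgX hM₁ hMg hnod hgp
    obtain ⟨ε₀, hε₀, hh⟩ := transvection_of_fixed_node_monomial hd1 M γ hγ hU _ f₁ g hf₁ hg hgX hnod hgp
    refine ⟨ε₀, hε₀, fun ε hε hεε s β ω hs hω T hT => ?_⟩
    obtain ⟨r, c, hr, hc, hT'⟩ := hh ε hε hεε t s β ω hs hω T hT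
    exact ⟨r, c, hr, hc, hT'⟩
  · -- exchanged pair `(±1:0:1:0:0)`
    intro f₁ g hf₁ hg hM₁ hMg hnod hgp
    have hq : ∃ t' : ℂ, γ • ((![![1, 0, 1, 0, 0], ![-1, 0, 1, 0, 0]] : Fin 2 → Fin 5 → ℂ) 1) =
        t' • ((![![1, 0, 1, 0, 0], ![-1, 0, 1, 0, 0]] : Fin 2 → Fin 5 → ℂ) 0) :=
      ⟨1, by funext i; fin_cases i <;> simp [γ]⟩
    obtain ⟨ε₀, hε₀, hh⟩ := SignSymmetricPowersPencilTransvectionsKeyed.transvections_of_exchanged_pair_keyed H hd1 M γ hγ hγfin hU _ hq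
      f₁ g hf₁ hg hM₁ hMg hnod hgp
    refine ⟨ε₀, hε₀, fun ε hε hεε s β ω hs hω T hT => ?_⟩
    obtain ⟨δ, c, hδ, hδ', hc, horth, hT'⟩ := hh ε hε hεε t s β ω hs hω T hT
    exact ⟨δ, c, hδ, hδ', hc, horth, hT'⟩

end Summit.HodgeConjecture.HodgeConjecture.Theorems.SignSymmetricPowersPencilTransvectionsPair

end
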